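import Summits.KontsevichZagierPeriods.KontsevichZagierPeriods.Theorems.ValuedFieldSpecialisationParametricLiftingStrata

/-!
# Route ValuedFieldSpecialisation — crux `ParametricLifting` (stmt-KontsevichZagierPeriods-3498):
# the fibre-graded regularised lifting RLG′ from the kernel conjecture on a level (lead c9, sub-goal W7)

Helper (`--supports stmt-KontsevichZagierPeriods-3498`) for line `registered`. Write level `E` :=
`AddSubgroup.closure {[r] | dim r < E}` and KL(`E`) := "every `x` on level `E` with `KZ.eval x = 0` is a
relation". **RLG′(`E`)** is the graded regularised lifting RLG(`E`) of the c7/c8 skeleton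
(`…ParametricLiftingGradedBootstrap.lean`, `…ParametricLiftingStrata.lean`) with ONE extra clause: the
dominated families `Rⱼ` of the regularised net have fibres of dimension `d₂ j < E`, i.e. the net certifying a
level-`E` element itself lives on level `E`. With this clause the special-fibre rigidity the bootstrap spends is
only the GRADED one (fibres of dimension `< E`), which is implied by KL(`E`) — so that level by level the pair
(regularised lifting, special-fibre rigidity) is exactly that level's kernel conjecture (lead c9 programme; the
step and the graded rigidity are the sibling sub-goals W6, W1).

This file: `stub_regLiftGradedLevel_of_kernelLevel` — **KL(`E`) ⇒ RLG′(`E`)** by the EMPTY net (`H = 0`, no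
divergent part, no dominated family, `−x ∈ KZ.relations`); the new clause is vacuous over `Fin 0`.

Sources: M. Kontsevich, D. Zagier, *Periods* (2001), §1.2, Conjecture 1. The fibred / dominated / elementary
vocabulary is this route's (`KZFibredRelations.lean`, `KZDominatedFamily.lean`). No definitions.
-/

noncomputable section

namespace Summit.KontsevichZagierPeriods.ValuedFieldSpecialisation

open MeasureTheory Set Filter
open scoped Topology
open Literature.NumberTheory.Transcendental

/-- **KL(`E`) ⇒ RLG′(`E`)** (lead c9 sub-goal W7): if every value-`0` formal combination of representations of
dimension `< E` is a relation, then the fibre-graded regularised lifting holds on level `E` — certified by the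
empty regularised net (`H = 0`; the divergent part, the dominated net and the fibre-dimension clause are all
indexed by `Fin 0`; `−x ∈ KZ.relations`). [cite: KontsevichZagier2001, §1.2 Conjecture 1] -/
theorem stub_regLiftGradedLevel_of_kernelLevel : ∀ (E : ℕ), (∀ (x : KZ.FormalRep), x ∈ AddSubgroup.closure {y : KZ.FormalRep | ∃ (n : ℕ) (r : KZ.IntegralRep n), n < E ∧ y = KZ.of r} → KZ.eval x = 0 → x ∈ KZ.relations) → (∀ (x : KZ.FormalRep), x ∈ AddSubgroup.closure {y : KZ.FormalRep | ∃ (n : ℕ) (r : KZ.IntegralRep n), n < E ∧ y = KZ.of r} → KZ.eval x = 0 → ∃ H ∈ KZ.fibredRelations, ∃ (k : ℕ) (m : Fin k → ℤ) (p q b d : Fin k → ℕ) (ρ : (i : Fin k) → KZ.IntegralRep (d i)) (P : (i : Fin k) → KZ.IntegralRep (b i + d i + 1 + 1)) (k₂ : ℕ) (d₂ : Fin k₂ → ℕ) (m₂ : Fin k₂ → ℤ) (R : (j : Fin k₂) → KZ.IntegralRep (d₂ j + 1)) (r₀ g : (j : Fin k₂) → KZ.IntegralRep (d₂ j)), (∀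 i, 0 < q i ∧ p i < q i ∧ (0 < p i ∨ 0 < b i) ∧ d i + 1 < E ∧ (P i).domain = {z | ∃ (s u : ℝ) (y : Fin (b i) → ℝ) (w : Fin (d i) → ℝ), z = Matrix.vecCons s (Matrix.vecCons u (Fin.append y w)) ∧ 0 < s ∧ s < 1 ∧ 0 < u ∧ u ^ (q i) * s ^ (p i) < 1 ∧ (∀ j, s ≤ y j ∧ y j ≤ 1) ∧ w ∈ (ρ i).domain} ∧ (P i).integrand = fun z => (∏ j : Fin (b i), (z (Fin.castAdd (d i) j).succ.succ)⁻¹) * (ρ i).integrand (fun l : Fin (d i) => z (Fin.natAdd (b i) l).succ.succ)) ∧ (∀ j, d₂ j < E ∧ KZ.IsDominatedFamily (R j) (r₀ j) (g j)) ∧ H = (∑ i, m i • KZ.of (P i)) + (∑ j, m₂ j • KZ.of (R j)) ∧ (∑ j, m₂ j • KZ.of (r₀ j)) - x ∈ KZ.relations) := by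
  intro E hK x hx hx0
  refine ⟨0, KZ.fibredRelations.zero_mem, 0, Fin.elim0, Fin.elim0, Fin.elim0, Fin.elim0, Fin.elim0,
    fun i => i.elim0, fun i => i.elim0, 0, Fin.elim0, Fin.elim0, fun j => j.elim0, fun j => j.elim0,
    fun j => j.elim0, fun i => i.elim0, fun j => j.elim0, by simp, ?_⟩
  simp only [Finset.univ_eq_empty, Finset.sum_empty, zero_sub]
  exact KZ.relations.neg_mem (hK x hx hx0)

end Summit.KontsevichZagierPeriods.ValuedFieldSpecialisation
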